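import Summits.QuantumFields.YangMills.Theorems.UnitScaleTiltProp7LinearCorrectorReality
import Summits.QuantumFields.YangMills.Theorems.UnitScaleTiltProp7LinearCorrectorMember
import Summits.QuantumFields.YangMills.Theorems.UnitScaleTiltProp7ExactCorrectorContractionGauge
import Summits.QuantumFields.YangMills.Theorems.UnitScaleTiltProp7GaugeRowsMaxSup
import HarnessLib

/-!
# Route `UnitScaleTilt`, crux K1 «MinimiserStabilityRegPr» (stmt-QuantumFields-19200), route-R E′ path (α′), (E1-e): THE EXACT CORRECTOR AT THE MEMBER —
# ✓ `Prop7ExactCorrectorContractionGauge.exists_unique_exact_corrector_gauge_of_mapsTo` INSTANTIATED at run `K`, level `K − n`, `SU(2)` background `W` of a T³ family, with EVERY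
# STRUCTURAL hypothesis discharged by kernel and EXACTLY the analytic rows left displayed: (hK), (hK₂) for `LinCorr`; `N 0 = 0` and the (E1-c) Lipschitz row for the chart remainder `N`;
# reality (Hermitian, traceless) of the datum `D` and of `N ψ`; the datum size `q D ≤ s`; the window `C_L·C_N·(7C_L s + s) ≤ 1∕2`

Cell `ym3-torus`, width seat `ym3-torus-px13` (gen 3); «(E1-e) MEMBER DOOR» (bus 2026-08-28T23:07Z; (E1-e) lineage under ★p1 g16's standing PASS).  THEOREMS ONLY (0 `def`, 0 `sorry`,
0 `instance`); `--supports stmt-QuantumFields-19200`, count-neutral.  YM₃ on T³ is a ladder rung (R3), not the Clay problem; nothing here claims the stub, the crux, d = 4 or the gap.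

ASSEMBLY (all ✓): `I`, `L` with pinning + reality ⟸ ✓ `Prop7LinearCorrectorReality.exists_linCorr_real_T3` (⟸ ✓p671932 ⟸ ✓p670222); door row `hL` ⟸ ✓ `Prop7LinearCorrectorMember.linCorr_gauge_le_of_rows_member`
(routeR-w3 g6, ⟸ ✓p671456) modulo (hK)(hK₂); gauge rows ⟸ ✓ `Prop7GaugeRowsMaxSup` fed by ✓ `Prop7ExactCorrectorGaugeSockets` (`covD_field_sub`, `norm_covD_field_le_T`); `hS` ⟸
✓ `isClosed_pinned_herm_traceZero`; completeness by instance; `hΦS` ⟸ `map_add` + pinning + reality rows.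

WHAT IS PROVED (ns `…Theorems.Prop7ExactCorrectorMember`).
* `mem_S_of_rows` — a site field pinned at the `(K−n)`-centres, pointwise Hermitian and traceless lies in `S`.
* ★★★ `exists_exact_corrector_member` — `∃ I L, ⟨the six conjuncts of ✓ exists_linCorr_real_T3 at k := K − n⟩ ∧ ∀ c_I c₂ ≥ 0, (hK) → (hK₂) → ∀ N D C_N s, … analytic rows … →
  ∃ ψ ∈ S, p ψ ≤ 3C_L s ∧ ψ = L D + L (N ψ) ∧ (unique in S ∩ {p ≤ 3C_L s})`, `C_L := max (3c_I∕2) (max c_I c₂)`, `S := {pinned at range (embIter (K−n)), Hermitian, traceless}`,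
  gauge `p ψ = max ‖ψ‖ (max (ℓ·‖D_Wψ‖) (ℓ·‖T₂ψ‖))` for ANY additive bounded `T₂` (the ρ₃ weight letter is the (hK₂) supplier's choice; ✓p669929 §4 serves `T₂ʷ`).
* (v1.1) ★★★ `exists_exact_corrector_member'` — the same with the remainder's reality row asked only on the ball `p ψ ≤ 3·C_L·s`.
HONEST SCOPE.  Plumbing only; the displayed rows are the open analytic content of (E1) ((hK)∕(hK₂): routeR-w3 g6's (E1-b) chain; `hN`: px15's (E1-c); `hD`, `hwin`: the knit's numerics).

References: T. Bałaban, CMP 102 (1985) 277–309 [Balaban1985Variational] (Prop. 7 p.299); CMP 99 (1985) 75–102 [Balaban1985RegularSpaces] ((1.14) p.78, (1.36) p.82);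
CMP 99 (1985) 389–434 [Balaban1985BackgroundPropagators] ((3.3) p.390, (3.8) p.392).
-/

set_option autoImplicit false

noncomputable section

open scoped BigOperators Matrix.Norms.L2Operator Matrix

namespace Summit.QuantumFields.YangMills.Theorems.Prop7ExactCorrectorMember

open Literature.MathematicalPhysics.QuantumFieldTheory.Balaban1983to89
open Literature.MathematicalPhysics.QuantumFieldTheory.Balaban1983to89.T3ContinuumYM3Torus
open B9Eq39Adjoint (covD divB)
open B9TorusCalculus (torusT)
open B15DeterminingSets (embIter)
open B10Eq27TorusAxialLog (unitsField toUField)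
open Summit.QuantumFields.YangMills.Theorems.Prop7ExactCorrectorGaugeSockets (covD_field_sub norm_covD_field_le_T isClosed_pinned_herm_traceZero)
open Summit.QuantumFields.YangMills.Theorems.Prop7GaugeRowsMaxSup (gauge_tri gauge_norm_le gauge_le_mul_norm)
open Summit.QuantumFields.YangMills.Theorems.Prop7ExactCorrectorContractionGauge (exists_unique_exact_corrector_gauge_of_mapsTo)
open Summit.QuantumFields.YangMills.Theorems.Prop7LinearCorrectorMember (linCorr_gauge_le_of_rows_member)
open Summit.QuantumFields.YangMills.Theorems.Prop7LinearCorrectorReality (exists_linCorr_real_T3)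

/-- Membership in the (E1-e) set `S = pinned ∧ Hermitian ∧ traceless` from the three rows. [cite: Balaban1985RegularSpaces, (1.14) p.78] -/
theorem mem_S_of_rows {P : Params} {k : ℕ} (ψ : Site P 0 → Matrix (Fin 2) (Fin 2) ℂ)
    (h0 : ∀ y : Site P k, ψ (embIter k y) = 0) (hH : ∀ x, (ψ x)ᴴ = ψ x) (hT : ∀ x, (ψ x).trace = 0) :
    ψ ∈ {ψ : Site P 0 → Matrix (Fin 2) (Fin 2) ℂ | (∀ c ∈ Set.range (embIter k), ψ c = 0) ∧ ∀ x, (ψ x)ᴴ = ψ x ∧ (ψ x).trace = 0} := by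
  refine ⟨?_, fun x => ⟨hH x, hT x⟩⟩
  rintro c ⟨y, rfl⟩
  exact h0 y

/-- ★★★ **THE EXACT CORRECTOR AT THE MEMBER, MODULO EXACTLY THE ANALYTIC ROWS.**  Run `K` of a T³ family, level `K − n`, ANY `SU(2)` background `W`, `ℓ = L^{K−n}`,
`𝒰 = unitsField (toUField W)`; ANY additive bounded `T₂` (the weighted second-order letter), the gauge `p ψ = max ‖ψ‖ (max (ℓ·‖D_𝒰ψ‖) (ℓ·‖T₂ψ‖))` and any size `q` with `ℓ²·‖D*_𝒰A‖_∞ ≤ q A`.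
Then there are the interpolation map `I` and the linear corrector `L` (characterised, pinned, reality-preserving — ✓ `exists_linCorr_real_T3`), and FOR ALL analytic data — rows (hK), (hK₂)
for `L` (`C_L := max (3c_I∕2) (max c_I c₂)`), a remainder map `N` with `N 0 = 0` and the (E1-c) Lipschitz row on `S ∩ {p ≤ 3C_L s}`, a Hermitian traceless datum `D` with `q D ≤ s`,
reality of `N ψ` on `S`, and the window `C_L·C_N·(7C_L s + s) ≤ 1∕2` — there is a UNIQUE `ψ ∈ S` (pinned, Hermitian, traceless), `p ψ ≤ 3C_L s`, with `ψ = L D + L (N ψ)`.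
[cite: Balaban1985Variational, Prop. 7 p.299; Balaban1985RegularSpaces, (1.14) p.78, (1.36) p.82; Balaban1985BackgroundPropagators, (3.3) p.390, (3.8) p.392] -/
theorem exists_exact_corrector_member (F : T3Family) (K n : ℕ) (W : GaugeField (F.P K) 0 (Matrix.specialUnitaryGroup (Fin 2) ℂ))
    {E₂ : Type*} [SeminormedAddCommGroup E₂] (T₂ : (Site (F.P K) 0 → Matrix (Fin 2) (Fin 2) ℂ) → E₂)
    (hT₂ : ∀ a b, T₂ (a - b) = T₂ a - T₂ b) {a₂ : ℝ} (hb₂ : ∀ ψ, ‖T₂ ψ‖ ≤ a₂ * ‖ψ‖)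
    (p : (Site (F.P K) 0 → Matrix (Fin 2) (Fin 2) ℂ) → ℝ)
    (hp : ∀ ψ, p ψ = max ‖ψ‖ (max ((F.L : ℝ) ^ (K - n) * ‖(fun μ z => covD (torusT (F.P K) 0) (fun κ z => unitsField (toUField W) ⟨z, κ⟩) μ ψ z)‖)
      ((F.L : ℝ) ^ (K - n) * ‖T₂ ψ‖)))
    (q : (Fin (F.P K).d → Site (F.P K) 0 → Matrix (Fin 2) (Fin 2) ℂ) → ℝ)
    (hq : ∀ A, ((F.L : ℝ) ^ (K - n)) ^ 2 * ‖(fun x => divB (torusT (F.P K) 0) (fun κ z => unitsField (toUField W) ⟨z, κ⟩) A x)‖ ≤ q A) :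
    ∃ (I : (Site (F.P K) 0 → Matrix (Fin 2) (Fin 2) ℂ) →+ (Site (F.P K) 0 → Matrix (Fin 2) (Fin 2) ℂ))
      (L : (Fin (F.P K).d → Site (F.P K) 0 → Matrix (Fin 2) (Fin 2) ℂ) →+ (Site (F.P K) 0 → Matrix (Fin 2) (Fin 2) ℂ)),
      -- (I) characterised
      (∀ φ, ((∀ y : Site (F.P K) (K - n), I φ (embIter (K - n) y) = φ (embIter (K - n) y)) ∧
          ∀ x : Site (F.P K) 0, x ∉ Set.range (embIter (K - n)) →
            divB (torusT (F.P K) 0) (fun κ z => unitsField (toUField W) ⟨z, κ⟩)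
              (fun μ => covD (torusT (F.P K) 0) (fun κ z => unitsField (toUField W) ⟨z, κ⟩) μ
                (fun y => divB (torusT (F.P K) 0) (fun κ z => unitsField (toUField W) ⟨z, κ⟩)
                  (fun ν => covD (torusT (F.P K) 0) (fun κ z => unitsField (toUField W) ⟨z, κ⟩) ν (I φ)) y)) x = 0) ∧
        ∀ χ, (∀ y : Site (F.P K) (K - n), χ (embIter (K - n) y) = φ (embIter (K - n) y)) →
          (∀ x : Site (F.P K) 0, x ∉ Set.range (embIter (K - n)) →
            divB (torusT (F.P K) 0) (fun κ z => unitsField (toUField W) ⟨z, κ⟩)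
              (fun μ => covD (torusT (F.P K) 0) (fun κ z => unitsField (toUField W) ⟨z, κ⟩) μ
                (fun y => divB (torusT (F.P K) 0) (fun κ z => unitsField (toUField W) ⟨z, κ⟩)
                  (fun ν => covD (torusT (F.P K) 0) (fun κ z => unitsField (toUField W) ⟨z, κ⟩) ν χ) y)) x = 0) → χ = I φ) ∧
      -- (L) for every potential
      (∀ A φ, (∀ x, divB (torusT (F.P K) 0) (fun κ z => unitsField (toUField W) ⟨z, κ⟩)
            (fun μ => covD (torusT (F.P K) 0) (fun κ z => unitsField (toUField W) ⟨z, κ⟩) μ φ) x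
          = divB (torusT (F.P K) 0) (fun κ z => unitsField (toUField W) ⟨z, κ⟩) A x) → L A = φ - I φ) ∧
      -- pinning
      (∀ (A) (y : Site (F.P K) (K - n)), L A (embIter (K - n) y) = 0) ∧
      -- potentials exist
      (∀ A, ∃ φ, (∀ x, divB (torusT (F.P K) 0) (fun κ z => unitsField (toUField W) ⟨z, κ⟩)
            (fun μ => covD (torusT (F.P K) 0) (fun κ z => unitsField (toUField W) ⟨z, κ⟩) μ φ) x
          = divB (torusT (F.P K) 0) (fun κ z => unitsField (toUField W) ⟨z, κ⟩) A x) ∧ L A = φ - I φ) ∧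
      -- reality
      (∀ A, (∀ μ x, (A μ x)ᴴ = A μ x) → ∀ x, (L A x)ᴴ = L A x) ∧
      (∀ A, (∀ μ x, (A μ x).trace = 0) → ∀ x, (L A x).trace = 0) ∧
      -- ★ the exact corrector modulo the analytic rows
      (∀ cI c₂ : ℝ, 0 ≤ cI → 0 ≤ c₂ →
        (∀ (A) (μ : Fin (F.P K).d) (x : Site (F.P K) 0),
          ‖covD (torusT (F.P K) 0) (fun κ z => unitsField (toUField W) ⟨z, κ⟩) μ (L A) x‖
            ≤ cI * (F.L : ℝ) ^ (K - n) * ‖(fun x => divB (torusT (F.P K) 0) (fun κ z => unitsField (toUField W) ⟨z, κ⟩) A x)‖) →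
        (∀ A, ‖T₂ (L A)‖ ≤ c₂ * (F.L : ℝ) ^ (K - n) * ‖(fun x => divB (torusT (F.P K) 0) (fun κ z => unitsField (toUField W) ⟨z, κ⟩) A x)‖) →
        ∀ (N : (Site (F.P K) 0 → Matrix (Fin 2) (Fin 2) ℂ) → (Fin (F.P K).d → Site (F.P K) 0 → Matrix (Fin 2) (Fin 2) ℂ))
          (D : Fin (F.P K).d → Site (F.P K) 0 → Matrix (Fin 2) (Fin 2) ℂ) (C_N s : ℝ), 0 ≤ C_N → 0 ≤ s → N 0 = 0 →
          (∀ ψ ψ', ψ ∈ {ψ : Site (F.P K) 0 → Matrix (Fin 2) (Fin 2) ℂ | (∀ c ∈ Set.range (embIter (K - n)), ψ c = 0) ∧ ∀ x, (ψ x)ᴴ = ψ x ∧ (ψ x).trace = 0} →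
            ψ' ∈ {ψ : Site (F.P K) 0 → Matrix (Fin 2) (Fin 2) ℂ | (∀ c ∈ Set.range (embIter (K - n)), ψ c = 0) ∧ ∀ x, (ψ x)ᴴ = ψ x ∧ (ψ x).trace = 0} →
            p ψ ≤ 3 * max (3 / 2 * cI) (max cI c₂) * s → p ψ' ≤ 3 * max (3 / 2 * cI) (max cI c₂) * s →
            q (N ψ - N ψ') ≤ C_N * (p ψ + p ψ' + s) * p (ψ - ψ')) →
          (∀ μ x, (D μ x)ᴴ = D μ x ∧ (D μ x).trace = 0) →
          (∀ ψ, ψ ∈ {ψ : Site (F.P K) 0 → Matrix (Fin 2) (Fin 2) ℂ | (∀ c ∈ Set.range (embIter (K - n)), ψ c = 0) ∧ ∀ x, (ψ x)ᴴ = ψ x ∧ (ψ x).trace = 0} →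
            ∀ μ x, (N ψ μ x)ᴴ = N ψ μ x ∧ (N ψ μ x).trace = 0) →
          q D ≤ s → max (3 / 2 * cI) (max cI c₂) * C_N * (7 * max (3 / 2 * cI) (max cI c₂) * s + s) ≤ 1 / 2 →
          ∃ ψ : Site (F.P K) 0 → Matrix (Fin 2) (Fin 2) ℂ,
            ψ ∈ {ψ : Site (F.P K) 0 → Matrix (Fin 2) (Fin 2) ℂ | (∀ c ∈ Set.range (embIter (K - n)), ψ c = 0) ∧ ∀ x, (ψ x)ᴴ = ψ x ∧ (ψ x).trace = 0} ∧
            p ψ ≤ 3 * max (3 / 2 * cI) (max cI c₂) * s ∧ ψ = L D + L (N ψ) ∧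
            ∀ ψ' : Site (F.P K) 0 → Matrix (Fin 2) (Fin 2) ℂ,
              ψ' ∈ {ψ : Site (F.P K) 0 → Matrix (Fin 2) (Fin 2) ℂ | (∀ c ∈ Set.range (embIter (K - n)), ψ c = 0) ∧ ∀ x, (ψ x)ᴴ = ψ x ∧ (ψ x).trace = 0} →
              p ψ' ≤ 3 * max (3 / 2 * cI) (max cI c₂) * s → ψ' = L D + L (N ψ') → ψ' = ψ) := by
  obtain ⟨I, L, hI, hL, hLC, hLex, hHerm, hTr⟩ := exists_linCorr_real_T3 F K (K - n) W
  refine ⟨I, L, hI, hL, hLC, hLex, hHerm, hTr, ?_⟩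
  intro cI c₂ hcI hc₂ hK hK₂ N D C_N s hCN hs hN0 hN hDreal hNreal hD hwin
  -- letters
  set ℓ : ℝ := (F.L : ℝ) ^ (K - n) with hℓdef
  have hℓ : 0 ≤ ℓ := pow_nonneg (Nat.cast_nonneg _) _
  set S : Set (Site (F.P K) 0 → Matrix (Fin 2) (Fin 2) ℂ) :=
    {ψ | (∀ c ∈ Set.range (embIter (K - n)), ψ c = 0) ∧ ∀ x, (ψ x)ᴴ = ψ x ∧ (ψ x).trace = 0} with hSdef
  set C_L : ℝ := max (3 / 2 * cI) (max cI c₂) with hCLdef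
  have hCL : 0 ≤ C_L := (hcI.trans (le_max_left _ _)).trans (le_max_right _ _)
  -- the door row `hL` modulo (hK)(hK₂)
  have hLrow : ∀ A, p (L A) ≤ C_L * q A :=
    linCorr_gauge_le_of_rows_member F K n W T₂ p hp q hq L hLC hcI hc₂ hK hK₂
  -- the gauge rows
  let T₁ : (Site (F.P K) 0 → Matrix (Fin 2) (Fin 2) ℂ) → (Fin (F.P K).d → Site (F.P K) 0 → Matrix (Fin 2) (Fin 2) ℂ) :=
    fun ψ => fun μ z => covD (torusT (F.P K) 0) (fun κ z => unitsField (toUField W) ⟨z, κ⟩) μ ψ z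
  have hp' : ∀ x, p x = max ‖x‖ (max (ℓ * ‖T₁ x‖) (ℓ * ‖T₂ x‖)) := hp
  have hT₁ : ∀ a b, T₁ (a - b) = T₁ a - T₁ b := fun a b => covD_field_sub (torusT (F.P K) 0) (fun κ z => unitsField (toUField W) ⟨z, κ⟩) a b
  have hp_tri := gauge_tri p T₁ T₂ hℓ hℓ hp' hT₁ hT₂
  have hp_norm := gauge_norm_le p T₁ T₂ ℓ ℓ hp'
  have hb₁ : ∀ x, ‖T₁ x‖ ≤ 2 * ‖x‖ := fun x => norm_covD_field_le_T W x
  have hp_le := gauge_le_mul_norm p T₁ T₂ hℓ hℓ hp' hb₁ hb₂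
  -- the set: closed, contains 0, invariant along the iteration
  have hS : IsClosed S := isClosed_pinned_herm_traceZero (Set.range (embIter (K - n))) 2
  have h0S : (0 : Site (F.P K) 0 → Matrix (Fin 2) (Fin 2) ℂ) ∈ S :=
    ⟨fun _ _ => rfl, fun x => ⟨by simp, by simp⟩⟩
  have hΦS : ∀ ψ, ψ ∈ S → p ψ ≤ 3 * C_L * s → L D + L (N ψ) ∈ S := by
    intro ψ hψS _
    rw [← map_add]
    have hAH : ∀ μ x, ((D + N ψ) μ x)ᴴ = (D + N ψ) μ x := fun μ x => by
      simp only [Pi.add_apply, Matrix.conjTranspose_add, (hDreal μ x).1, (hNreal ψ hψS μ x).1]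
    have hAT : ∀ μ x, ((D + N ψ) μ x).trace = 0 := fun μ x => by
      simp only [Pi.add_apply, Matrix.trace_add, (hDreal μ x).2, (hNreal ψ hψS μ x).2, add_zero]
    exact mem_S_of_rows (L (D + N ψ)) (hLC (D + N ψ)) (hHerm (D + N ψ) hAH) (hTr (D + N ψ) hAT)
  -- the door
  exact exists_unique_exact_corrector_gauge_of_mapsTo S p q L N D hCL hCN hs hp_tri hp_norm hp_le hS h0S hΦS hLrow hN0 hN hD hwin

/-- ★★★ **THE EXACT CORRECTOR AT THE MEMBER (v1.1 — reality of `N ψ` asked only ON THE BALL).**  Identical to `exists_exact_corrector_member` except that the displayed reality row for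
the remainder reads `∀ ψ ∈ S, p ψ ≤ 3·C_L·s → (N ψ Hermitian ∧ traceless)` — the form the (E1-c)→(E1-e) junction can inhabit (the series `mlog` is only meaningful near `1`); the
door ✓ `exists_unique_exact_corrector_gauge_of_mapsTo` needs no more. [cite: Balaban1985Variational, Prop. 7 p.299; Balaban1985RegularSpaces, (1.14) p.78] -/
theorem exists_exact_corrector_member' (F : T3Family) (K n : ℕ) (W : GaugeField (F.P K) 0 (Matrix.specialUnitaryGroup (Fin 2) ℂ))
    {E₂ : Type*} [SeminormedAddCommGroup E₂] (T₂ : (Site (F.P K) 0 → Matrix (Fin 2) (Fin 2) ℂ) → E₂)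
    (hT₂ : ∀ a b, T₂ (a - b) = T₂ a - T₂ b) {a₂ : ℝ} (hb₂ : ∀ ψ, ‖T₂ ψ‖ ≤ a₂ * ‖ψ‖)
    (p : (Site (F.P K) 0 → Matrix (Fin 2) (Fin 2) ℂ) → ℝ)
    (hp : ∀ ψ, p ψ = max ‖ψ‖ (max ((F.L : ℝ) ^ (K - n) * ‖(fun μ z => covD (torusT (F.P K) 0) (fun κ z => unitsField (toUField W) ⟨z, κ⟩) μ ψ z)‖)
      ((F.L : ℝ) ^ (K - n) * ‖T₂ ψ‖)))
    (q : (Fin (F.P K).d → Site (F.P K) 0 → Matrix (Fin 2) (Fin 2) ℂ) → ℝ)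
    (hq : ∀ A, ((F.L : ℝ) ^ (K - n)) ^ 2 * ‖(fun x => divB (torusT (F.P K) 0) (fun κ z => unitsField (toUField W) ⟨z, κ⟩) A x)‖ ≤ q A) :
    ∃ (I : (Site (F.P K) 0 → Matrix (Fin 2) (Fin 2) ℂ) →+ (Site (F.P K) 0 → Matrix (Fin 2) (Fin 2) ℂ))
      (L : (Fin (F.P K).d → Site (F.P K) 0 → Matrix (Fin 2) (Fin 2) ℂ) →+ (Site (F.P K) 0 → Matrix (Fin 2) (Fin 2) ℂ)),
      -- (I) characterised
      (∀ φ, ((∀ y : Site (F.P K) (K - n), I φ (embIter (K - n) y) = φ (embIter (K - n) y)) ∧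
          ∀ x : Site (F.P K) 0, x ∉ Set.range (embIter (K - n)) →
            divB (torusT (F.P K) 0) (fun κ z => unitsField (toUField W) ⟨z, κ⟩)
              (fun μ => covD (torusT (F.P K) 0) (fun κ z => unitsField (toUField W) ⟨z, κ⟩) μ
                (fun y => divB (torusT (F.P K) 0) (fun κ z => unitsField (toUField W) ⟨z, κ⟩)
                  (fun ν => covD (torusT (F.P K) 0) (fun κ z => unitsField (toUField W) ⟨z, κ⟩) ν (I φ)) y)) x = 0) ∧
        ∀ χ, (∀ y : Site (F.P K) (K - n), χ (embIter (K - n) y) = φ (embIter (K - n) y)) →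
          (∀ x : Site (F.P K) 0, x ∉ Set.range (embIter (K - n)) →
            divB (torusT (F.P K) 0) (fun κ z => unitsField (toUField W) ⟨z, κ⟩)
              (fun μ => covD (torusT (F.P K) 0) (fun κ z => unitsField (toUField W) ⟨z, κ⟩) μ
                (fun y => divB (torusT (F.P K) 0) (fun κ z => unitsField (toUField W) ⟨z, κ⟩)
                  (fun ν => covD (torusT (F.P K) 0) (fun κ z => unitsField (toUField W) ⟨z, κ⟩) ν χ) y)) x = 0) → χ = I φ) ∧
      -- (L) for every potential
      (∀ A φ, (∀ x, divB (torusT (F.P K) 0) (fun κ z => unitsField (toUField W) ⟨z, κ⟩)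
            (fun μ => covD (torusT (F.P K) 0) (fun κ z => unitsField (toUField W) ⟨z, κ⟩) μ φ) x
          = divB (torusT (F.P K) 0) (fun κ z => unitsField (toUField W) ⟨z, κ⟩) A x) → L A = φ - I φ) ∧
      -- pinning
      (∀ (A) (y : Site (F.P K) (K - n)), L A (embIter (K - n) y) = 0) ∧
      -- potentials exist
      (∀ A, ∃ φ, (∀ x, divB (torusT (F.P K) 0) (fun κ z => unitsField (toUField W) ⟨z, κ⟩)
            (fun μ => covD (torusT (F.P K) 0) (fun κ z => unitsField (toUField W) ⟨z, κ⟩) μ φ) x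
          = divB (torusT (F.P K) 0) (fun κ z => unitsField (toUField W) ⟨z, κ⟩) A x) ∧ L A = φ - I φ) ∧
      -- reality
      (∀ A, (∀ μ x, (A μ x)ᴴ = A μ x) → ∀ x, (L A x)ᴴ = L A x) ∧
      (∀ A, (∀ μ x, (A μ x).trace = 0) → ∀ x, (L A x).trace = 0) ∧
      -- ★ the exact corrector modulo the analytic rows
      (∀ cI c₂ : ℝ, 0 ≤ cI → 0 ≤ c₂ →
        (∀ (A) (μ : Fin (F.P K).d) (x : Site (F.P K) 0),
          ‖covD (torusT (F.P K) 0) (fun κ z => unitsField (toUField W) ⟨z, κ⟩) μ (L A) x‖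
            ≤ cI * (F.L : ℝ) ^ (K - n) * ‖(fun x => divB (torusT (F.P K) 0) (fun κ z => unitsField (toUField W) ⟨z, κ⟩) A x)‖) →
        (∀ A, ‖T₂ (L A)‖ ≤ c₂ * (F.L : ℝ) ^ (K - n) * ‖(fun x => divB (torusT (F.P K) 0) (fun κ z => unitsField (toUField W) ⟨z, κ⟩) A x)‖) →
        ∀ (N : (Site (F.P K) 0 → Matrix (Fin 2) (Fin 2) ℂ) → (Fin (F.P K).d → Site (F.P K) 0 → Matrix (Fin 2) (Fin 2) ℂ))
          (D : Fin (F.P K).d → Site (F.P K) 0 → Matrix (Fin 2) (Fin 2) ℂ) (C_N s : ℝ), 0 ≤ C_N → 0 ≤ s → N 0 = 0 →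
          (∀ ψ ψ', ψ ∈ {ψ : Site (F.P K) 0 → Matrix (Fin 2) (Fin 2) ℂ | (∀ c ∈ Set.range (embIter (K - n)), ψ c = 0) ∧ ∀ x, (ψ x)ᴴ = ψ x ∧ (ψ x).trace = 0} →
            ψ' ∈ {ψ : Site (F.P K) 0 → Matrix (Fin 2) (Fin 2) ℂ | (∀ c ∈ Set.range (embIter (K - n)), ψ c = 0) ∧ ∀ x, (ψ x)ᴴ = ψ x ∧ (ψ x).trace = 0} →
            p ψ ≤ 3 * max (3 / 2 * cI) (max cI c₂) * s → p ψ' ≤ 3 * max (3 / 2 * cI) (max cI c₂) * s →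
            q (N ψ - N ψ') ≤ C_N * (p ψ + p ψ' + s) * p (ψ - ψ')) →
          (∀ μ x, (D μ x)ᴴ = D μ x ∧ (D μ x).trace = 0) →
          (∀ ψ, ψ ∈ {ψ : Site (F.P K) 0 → Matrix (Fin 2) (Fin 2) ℂ | (∀ c ∈ Set.range (embIter (K - n)), ψ c = 0) ∧ ∀ x, (ψ x)ᴴ = ψ x ∧ (ψ x).trace = 0} →
            p ψ ≤ 3 * max (3 / 2 * cI) (max cI c₂) * s → ∀ μ x, (N ψ μ x)ᴴ = N ψ μ x ∧ (N ψ μ x).trace = 0) →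
          q D ≤ s → max (3 / 2 * cI) (max cI c₂) * C_N * (7 * max (3 / 2 * cI) (max cI c₂) * s + s) ≤ 1 / 2 →
          ∃ ψ : Site (F.P K) 0 → Matrix (Fin 2) (Fin 2) ℂ,
            ψ ∈ {ψ : Site (F.P K) 0 → Matrix (Fin 2) (Fin 2) ℂ | (∀ c ∈ Set.range (embIter (K - n)), ψ c = 0) ∧ ∀ x, (ψ x)ᴴ = ψ x ∧ (ψ x).trace = 0} ∧
            p ψ ≤ 3 * max (3 / 2 * cI) (max cI c₂) * s ∧ ψ = L D + L (N ψ) ∧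
            ∀ ψ' : Site (F.P K) 0 → Matrix (Fin 2) (Fin 2) ℂ,
              ψ' ∈ {ψ : Site (F.P K) 0 → Matrix (Fin 2) (Fin 2) ℂ | (∀ c ∈ Set.range (embIter (K - n)), ψ c = 0) ∧ ∀ x, (ψ x)ᴴ = ψ x ∧ (ψ x).trace = 0} →
              p ψ' ≤ 3 * max (3 / 2 * cI) (max cI c₂) * s → ψ' = L D + L (N ψ') → ψ' = ψ) := by
  obtain ⟨I, L, hI, hL, hLC, hLex, hHerm, hTr⟩ := exists_linCorr_real_T3 F K (K - n) W
  refine ⟨I, L, hI, hL, hLC, hLex, hHerm, hTr, ?_⟩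
  intro cI c₂ hcI hc₂ hK hK₂ N D C_N s hCN hs hN0 hN hDreal hNreal hD hwin
  -- letters
  set ℓ : ℝ := (F.L : ℝ) ^ (K - n) with hℓdef
  have hℓ : 0 ≤ ℓ := pow_nonneg (Nat.cast_nonneg _) _
  set S : Set (Site (F.P K) 0 → Matrix (Fin 2) (Fin 2) ℂ) :=
    {ψ | (∀ c ∈ Set.range (embIter (K - n)), ψ c = 0) ∧ ∀ x, (ψ x)ᴴ = ψ x ∧ (ψ x).trace = 0} with hSdef
  set C_L : ℝ := max (3 / 2 * cI) (max cI c₂) with hCLdef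
  have hCL : 0 ≤ C_L := (hcI.trans (le_max_left _ _)).trans (le_max_right _ _)
  -- the door row `hL` modulo (hK)(hK₂)
  have hLrow : ∀ A, p (L A) ≤ C_L * q A :=
    linCorr_gauge_le_of_rows_member F K n W T₂ p hp q hq L hLC hcI hc₂ hK hK₂
  -- the gauge rows
  let T₁ : (Site (F.P K) 0 → Matrix (Fin 2) (Fin 2) ℂ) → (Fin (F.P K).d → Site (F.P K) 0 → Matrix (Fin 2) (Fin 2) ℂ) :=
    fun ψ => fun μ z => covD (torusT (F.P K) 0) (fun κ z => unitsField (toUField W) ⟨z, κ⟩) μ ψ z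
  have hp' : ∀ x, p x = max ‖x‖ (max (ℓ * ‖T₁ x‖) (ℓ * ‖T₂ x‖)) := hp
  have hT₁ : ∀ a b, T₁ (a - b) = T₁ a - T₁ b := fun a b => covD_field_sub (torusT (F.P K) 0) (fun κ z => unitsField (toUField W) ⟨z, κ⟩) a b
  have hp_tri := gauge_tri p T₁ T₂ hℓ hℓ hp' hT₁ hT₂
  have hp_norm := gauge_norm_le p T₁ T₂ ℓ ℓ hp'
  have hb₁ : ∀ x, ‖T₁ x‖ ≤ 2 * ‖x‖ := fun x => norm_covD_field_le_T W x
  have hp_le := gauge_le_mul_norm p T₁ T₂ hℓ hℓ hp' hb₁ hb₂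
  -- the set: closed, contains 0, invariant along the iteration
  have hS : IsClosed S := isClosed_pinned_herm_traceZero (Set.range (embIter (K - n))) 2
  have h0S : (0 : Site (F.P K) 0 → Matrix (Fin 2) (Fin 2) ℂ) ∈ S :=
    ⟨fun _ _ => rfl, fun x => ⟨by simp, by simp⟩⟩
  have hΦS : ∀ ψ, ψ ∈ S → p ψ ≤ 3 * C_L * s → L D + L (N ψ) ∈ S := by
    intro ψ hψS hψB
    rw [← map_add]
    have hAH : ∀ μ x, ((D + N ψ) μ x)ᴴ = (D + N ψ) μ x := fun μ x => by
      simp only [Pi.add_apply, Matrix.conjTranspose_add, (hDreal μ x).1, (hNreal ψ hψS hψB μ x).1]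
    have hAT : ∀ μ x, ((D + N ψ) μ x).trace = 0 := fun μ x => by
      simp only [Pi.add_apply, Matrix.trace_add, (hDreal μ x).2, (hNreal ψ hψS hψB μ x).2, add_zero]
    exact mem_S_of_rows (L (D + N ψ)) (hLC (D + N ψ)) (hHerm (D + N ψ) hAH) (hTr (D + N ψ) hAT)
  -- the door
  exact exists_unique_exact_corrector_gauge_of_mapsTo S p q L N D hCL hCN hs hp_tri hp_norm hp_le hS h0S hΦS hLrow hN0 hN hD hwin

end Summit.QuantumFields.YangMills.Theorems.Prop7ExactCorrectorMember

end
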